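import Mathlib
import Summits.NavierStokesRegularity.NavierStokesRegularity.Theorems.ThreadingFluxHorizonTowerDefs
import Summits.NavierStokesRegularity.NavierStokesRegularity.Theorems.ThreadingFluxHorizonTowerPoloidalFieldCalculus
import Summits.NavierStokesRegularity.NavierStokesRegularity.Theorems.ThreadingFluxHorizonTowerZonalBridge
import Summits.NavierStokesRegularity.NavierStokesRegularity.Theorems.ThreadingFluxHorizonTowerZonalIsotropicAxis
import HarnessLib

/-!
# Crux `PoloidalLiouville` (stmt-NavierStokesRegularity-1222, W1/W2), crux idea «linear-loop-law» (ns-idea-15 g3):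
# SAME-DEGREE BRACKET RIGIDITY AT DEGREE 1 — `SameDegreeBracketRigidityAt 1` of
# `Cruxes/PoloidalLiouville/LoopLawSketch.lean`, PROVED (body VERBATIM)

Support file (`--supports stmt-NavierStokesRegularity-1222`, helper).  Experiment cell `ns-wall-extremal`, width hand
ns-wall-eng-4 g3.  0 kit.  Statement = the sketch's `SameDegreeBracketRigidityAt 1` with `IsSolidHarmonic`, `peval`,
`loopBracket` unfolded (the card's own remark: «l = 1: det(y, a, b) ≡ 0 ⇒ a ∥ b»; the `l = 1` regime is ns-idea-13's
`TwistedCapNoTwist` regime).  PROOF: a smooth function with `H(c y) = c H(y)` is linear, `H = ⟪a, ·⟫` with `a = ∇H(0)`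
(differentiate `t ↦ H(t y)` at `0`); the bracket is `⟪y, a × b⟫ ≡ 0`, so `a × b = 0`, so `b = c a` (Lagrange's identity
through `‖a × w‖ = ‖a‖ ‖w‖ sin∠(a, w)`); polynomials over `ℝ` are determined by their values.

HONEST FRAME: finite-dimensional algebra; rungs untouched; 1222 / 27585 and NS regularity stay OPEN.
-/

-- the summit and its single problem share the name (D-0017 nested layout)
set_option linter.dupNamespace false

noncomputable section

namespace Summit.NavierStokesRegularity.NavierStokesRegularity.Theorems.PoloidalLiouville.LoopLaw

open Set Function Filter Topology
open scoped RealInnerProductSpace Topology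
open Literature.Analysis.FluidPDE
open Summit.NavierStokesRegularity.NavierStokesRegularity.Theorems.PoloidalLiouville.HorizonTower

/-- A smooth function with `H (c • y) = c * H y` for all real `c` is the linear functional `⟪∇H(0), ·⟫`, and its gradient
is constant. -/
theorem linear_of_oneHomogeneous {H : E3 → ℝ} (hH : ContDiff ℝ 1 H)
    (hhom : ∀ (c : ℝ) (y : E3), H (c • y) = c * H y) :
    (∀ y : E3, H y = ⟪gradient H 0, y⟫) ∧ ∀ y : E3, gradient H y = gradient H 0 := by
  have hd : ∀ y, DifferentiableAt ℝ H y := fun y => (hH.differentiable (by norm_num)) y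
  have hlin : ∀ y : E3, H y = ⟪gradient H 0, y⟫ := by
    intro y
    -- differentiate `t ↦ H (t • y) = t * H y` at `t = 0`
    have h1 : HasDerivAt (fun t : ℝ => H (t • y)) (fderiv ℝ H 0 y) 0 := by
      have hl : HasDerivAt (fun t : ℝ => t • y) y 0 := by simpa using (hasDerivAt_id (0 : ℝ)).smul_const y
      have hf : HasFDerivAt H (fderiv ℝ H 0) ((0 : ℝ) • y) := by rw [zero_smul]; exact (hd 0).hasFDerivAt
      exact hf.comp_hasDerivAt 0 hl
    have h2 : HasDerivAt (fun t : ℝ => H (t • y)) (H y) 0 := by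
      have : (fun t : ℝ => H (t • y)) = fun t => t * H y := funext fun t => hhom t y
      rw [this]; simpa using (hasDerivAt_id (0 : ℝ)).mul_const (H y)
    rw [Literature.Analysis.FluidPDE.inner_gradient_left, ← h1.unique h2]
  refine ⟨hlin, fun y => ?_⟩
  apply ext_inner_right ℝ
  intro v
  rw [Literature.Analysis.FluidPDE.inner_gradient_left]
  have hfun' : H = ⇑(innerSL ℝ (gradient H 0)) := by
    funext z; rw [innerSL_apply_apply]; exact hlin z
  conv_lhs => rw [hfun']
  rw [(innerSL ℝ (gradient H 0)).fderiv, innerSL_apply_apply]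

/-- **SAME-DEGREE BRACKET RIGIDITY AT `l = 1`** (body of the sketch's `SameDegreeBracketRigidityAt 1`, VERBATIM with
`IsSolidHarmonic`, `peval`, `loopBracket` unfolded): `det(y, a, b) ≡ 0 ⇒ b ∥ a`. -/
theorem sameDegreeBracketRigidityAt_one :
    ∀ (A B : MvPolynomial (Fin 3) ℝ),
      (A.IsHomogeneous 1 ∧ ∀ y : E3, Laplacian.laplacian (fun y : E3 => MvPolynomial.eval (fun i => y i) A) y = 0) →
      (B.IsHomogeneous 1 ∧ ∀ y : E3, Laplacian.laplacian (fun y : E3 => MvPolynomial.eval (fun i => y i) B) y = 0) →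
      A ≠ 0 →
      (∀ y : E3, inner ℝ y (cross (gradient (fun y : E3 => MvPolynomial.eval (fun i => y i) A) y)
        (gradient (fun y : E3 => MvPolynomial.eval (fun i => y i) B) y)) = 0) →
      ∃ c : ℝ, B = c • A := by
  intro A B hA hB hA0 hbr
  -- the two linear functionals
  have hlinP : ∀ P : MvPolynomial (Fin 3) ℝ, P.IsHomogeneous 1 →
      (∀ y : E3, Zonal.evalE P y = ⟪gradient (Zonal.evalE P) 0, y⟫) ∧
        ∀ y : E3, gradient (Zonal.evalE P) y = gradient (Zonal.evalE P) 0 := by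
    intro P hP
    refine linear_of_oneHomogeneous ((Zonal.contDiff_evalE P).of_le (by norm_cast)) fun c y => ?_
    have h := Zonal.eval_smul_of_isHomogeneous hP c (fun i => y i)
    simpa [Zonal.evalE] using h
  obtain ⟨hAlin, hAgrad⟩ := hlinP A hA.1
  obtain ⟨hBlin, hBgrad⟩ := hlinP B hB.1
  set a : E3 := gradient (Zonal.evalE A) 0 with ha
  set b : E3 := gradient (Zonal.evalE B) 0 with hb
  -- the bracket condition: `a × b = 0`
  have hcross : cross a b = 0 := by
    have h := hbr (cross a b)
    change ⟪cross a b, cross (gradient (Zonal.evalE A) (cross a b)) (gradient (Zonal.evalE B) (cross a b))⟫ = 0 at h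
    rw [hAgrad, hBgrad] at h
    exact inner_self_eq_zero.mp h
  -- `a ≠ 0`
  have ha0 : a ≠ 0 := by
    intro h0
    apply hA0
    apply Zonal.eq_zero_of_evalE_eq_zero
    intro y
    rw [hAlin, h0, inner_zero_left]
  -- `b = c • a`
  set c : ℝ := ⟪a, b⟫ / ‖a‖ ^ 2 with hc
  have hna : ‖a‖ ^ 2 ≠ 0 := by positivity
  have hw : b - c • a = 0 := by
    set w : E3 := b - c • a with hw'
    have hsl : cross a (c • a) = c • cross a a := by
      rw [← crossCLM_apply, ← crossCLM_apply, map_smul]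
    have hcw : cross a w = 0 := by
      rw [hw', ← crossCLM_apply, map_sub, crossCLM_apply, crossCLM_apply, hcross, hsl, Tao2016.cross_self_eq_zero,
        smul_zero, sub_zero]
    have hiw : ⟪a, w⟫ = 0 := by
      rw [hw', inner_sub_right, inner_smul_right, real_inner_self_eq_norm_sq, hc, div_mul_cancel₀ _ hna, sub_self]
    by_contra hne
    have hang : InnerProductGeometry.angle a w = Real.pi / 2 :=
      (InnerProductGeometry.inner_eq_zero_iff_angle_eq_pi_div_two a w).mp hiw
    have hnorm := norm_cross a w
    rw [hcw, norm_zero, hang, Real.sin_pi_div_two, mul_one] at hnorm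
    have : ‖a‖ * ‖w‖ ≠ 0 := mul_ne_zero (norm_ne_zero_iff.mpr ha0) (norm_ne_zero_iff.mpr hne)
    exact this hnorm.symm
  have hbca : b = c • a := sub_eq_zero.mp hw
  refine ⟨c, ?_⟩
  have hzero : B - c • A = 0 := by
    apply Zonal.eq_zero_of_evalE_eq_zero
    intro y
    have hBy : Zonal.evalE B y = c * Zonal.evalE A y := by
      rw [hBlin, hAlin, hbca, real_inner_smul_left]
    simp only [Zonal.evalE, map_sub, MvPolynomial.smul_eval] at hBy ⊢
    linarith
  exact sub_eq_zero.mp hzero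

end Summit.NavierStokesRegularity.NavierStokesRegularity.Theorems.PoloidalLiouville.LoopLaw

end
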